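import Literature.Computability.AlgebraicComplexity.DDS21GenericShiftRegular
import HarnessLib

/-!
# Dutta–Dwivedi–Saxena 2021, §3: the stage-0 input in regular position (proved)

Theorem-only companion (cell `val-lit`, np lane, DDS21 Thm 3.2 programme "M-b", lead-np RULINGS
(148)(b)/(150)(d): the STAGE-0 instantiation glue of the `(A′)` architecture) for P. Dutta,
P. Dwivedi, N. Saxena, *Demystifying the border of depth-3 algebraic circuits*, FOCS 2021
[DuttaDwivediSaxena2022], held full version `paper:galaxy-pdf-7641649743695546420`.

Sibling of `DDS21GenericShiftRegular.lean` (which proves that a NONZERO affine form over `F(ε)`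
becomes `ε`-regular after base change to `F′ ⊇ F(y)` and the generic shift). This file supplies
the two facts the stage-0 glue needs BEFORE that lemma applies, and packages the result:

* `none_ne_zero_of_regular` — an `ε`-regular coefficient vector has a nonzero constant entry
  (print's literal "`T_{i,0}(α) ≠ 0`", p0028 L753–754; the field `hL` of the tree's DiDIL
  records). This is THE public copy of record (used by name in `AC/DDS21TranscriptResidues.lean`
  v2, which imports this file).
* `exists_isEpsApprox_forall_ne_zero` — WLOG ALL `k·d` affine forms of the approximating
  `Σ^{[k]}Π^{[d]}Σ` circuit are NONZERO: a product with a zero form is `0` and is replaced by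
  `ε^d` (`d ≥ 1`), which keeps "`g = f + ε·Q`" (Def. 2.1). The printed proof tacitly assumes
  `T_{i,0} ≠ 0`.
* ★ `exists_forms_regular_generic_shift` — for `f ∈ \overline{Σ^{[k]}Π^{[d]}Σ}`: nonzero
  forms
  `α i j` approximating `f`, and for ANY shifted base change `a′` over the generic point
  (characterising hypotheses) every `a′ i j` is `ε`-regular (the hypothesis `ha` of
  `exists_regularModel_prod_affine`, `DDS21DiDILEndGame.lean` §1, per `i`) with
  `a′ i j none ≠ 0`.

0 definitions, 0 named facts. Honest framing: bookkeeping for a published 2021 theorem;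
`DDS2021_thm_3_2` remains an OPEN named fact; VP ≠ VNP is NOT proved.

## References

* [DuttaDwivediSaxena2022] P. Dutta, P. Dwivedi, N. Saxena, *Demystifying the border of depth-3
  algebraic circuits*, Proc. 62nd FOCS (2021), IEEE 2022, 92–103; full version: Def. 2.1 p0016
  L416–419; Def. 3.1 p0026 L702–707; the map `Φ` and the random point p0028 L751–754.
-/

open MvPolynomial
open scoped BigOperators Polynomial

namespace Literature.Computability.AlgebraicComplexity

namespace DDS2021

/-! ## Nonzero constant terms; all forms nonzero WLOG; packaging -/

section Consequences

variable {F : Type*} [Field F] {n : ℕ}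

/-- An `ε`-regular vector has a NONZERO constant entry: `a′₀ = c · ι(b₀)` with `c ≠ 0`
and `b₀(0) ≠ 0` (so `b₀ ≠ 0`) — print's literal "`T_{i,0}(α) ≠ 0`", and the field
`hL : ∀ a ∈ L, a none ≠ 0` of the tree's DiDIL records (`DDS21DiDILStep.lean`). Public copy of
record (the concurrent copy in `AC/DDS21TranscriptResidues.lean` v1 was removed by its v2, which
imports this file and uses this lemma by name).
[cite: DuttaDwivediSaxena2022, §3 proof of Thm. 3.2, "`Φ(T_{i,0})|_{x=0} = T_{i,0}(α) ≠ 0`" (full version p0028 L751–754)] -/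
theorem none_ne_zero_of_regular {K : Type*} [Field K]
    {a' : Option (Fin n) → RatFunc K}
    (h : ∃ (c : RatFunc K) (b : Option (Fin n) → K[X]), c ≠ 0 ∧
      (∀ o, a' o = c * algebraMap K[X] (RatFunc K) (b o)) ∧ (b none).coeff 0 ≠ 0) :
    a' none ≠ 0 := by
  obtain ⟨c, b, hc, hab, hb⟩ := h
  rw [hab none]
  refine mul_ne_zero hc ((map_ne_zero_iff _ (RatFunc.algebraMap_injective K)).mpr ?_)
  intro hb0
  exact hb (by rw [hb0, Polynomial.coeff_zero])

/-- The affine form with coefficient vector `0` is the zero polynomial. (folklore)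
[cite: DuttaDwivediSaxena2022, Def. 3.1 (full version p0026 L702–707)] -/
theorem affForm_zero {K : Type*} [CommSemiring K] :
    (C ((0 : Option (Fin n) → K) none) + ∑ m, C ((0 : Option (Fin n) → K) (some m)) * X m :
      MvPolynomial (Fin n) K) = 0 := by
  simp

/-- **WLOG every affine form is nonzero.** If `f ∈ \overline{Σ^{[k]}Π^{[d]}Σ}` then `f` is
approximated by a `Σ^{[k]}Π^{[d]}Σ` circuit over `F(ε)` ALL of whose `k·d` affine forms are
NONZERO: a product containing a zero form is `0` and is replaced by `ε^d = ∏_{j<d} ε`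
(for `d ≥ 1`; for `d = 0` there are no forms), which changes `g = f + ε·Q` by a multiple of
`ε^d` and so still approximates `f`. (The printed proof tacitly assumes `T_{i,0} ≠ 0`.)
[cite: DuttaDwivediSaxena2022, Def. 2.1 (full version p0016 L416–419) and §3 proof of Thm. 3.2 (p0028 L751–754)] -/
theorem exists_isEpsApprox_forall_ne_zero {k d : ℕ} {f : MvPolynomial (Fin n) F}
    (hf : f ∈ border (spsClass (RatFunc F) n k d)) :
    ∃ α : Fin k → Fin d → Option (Fin n) → RatFunc F, (∀ i j, α i j ≠ 0) ∧
      MS2021.IsEpsApprox f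
        (∑ i, ∏ j, (C (α i j none) + ∑ m, C (α i j (some m)) * X m)) := by
  classical
  obtain ⟨g, ⟨α, rfl⟩, hfg⟩ := hf
  obtain ⟨G, hGg, hGf⟩ := isEpsApprox_iff_exists_map.mp hfg
  -- the constant form `ε`
  let eps : Option (Fin n) → RatFunc F :=
    fun o => o.elim (algebraMap F[X] (RatFunc F) Polynomial.X) fun _ => 0
  have heps : (C (eps none) + ∑ m, C (eps (some m)) * X m : MvPolynomial (Fin n) (RatFunc F)) =
      C (algebraMap F[X] (RatFunc F) Polynomial.X) := by
    simp [eps]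
  have heps0 : eps ≠ 0 := by
    intro h
    have h1 : eps none = 0 := by rw [h, Pi.zero_apply]
    exact (map_ne_zero_iff _ (RatFunc.algebraMap_injective F)).mpr Polynomial.X_ne_zero h1
  -- good indices: all forms nonzero
  let good : Fin k → Prop := fun i => ∀ j, α i j ≠ 0
  let α' : Fin k → Fin d → Option (Fin n) → RatFunc F :=
    fun i j => if good i then α i j else eps
  have hbad : ∀ i, ¬ good i →
      (∏ j, (C (α i j none) + ∑ m, C (α i j (some m)) * X m) :
        MvPolynomial (Fin n) (RatFunc F)) = 0 := by
    intro i hi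
    simp only [good, not_forall, not_not] at hi
    obtain ⟨j, hj⟩ := hi
    refine Finset.prod_eq_zero (Finset.mem_univ j) ?_
    rw [hj]
    exact affForm_zero
  -- the correction term
  let corr : Fin k → MvPolynomial (Fin n) F[X] :=
    fun i => if good i then 0 else C (Polynomial.X ^ d)
  have hsum : (∑ i, ∏ j, (C (α' i j none) + ∑ m, C (α' i j (some m)) * X m) :
      MvPolynomial (Fin n) (RatFunc F)) =
      (∑ i, ∏ j, (C (α i j none) + ∑ m, C (α i j (some m)) * X m)) +
        ∑ i, map (algebraMap F[X] (RatFunc F)) (corr i) := by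
    rw [← Finset.sum_add_distrib]
    refine Finset.sum_congr rfl fun i _ => ?_
    by_cases hi : good i
    · simp only [α', corr, if_pos hi, map_zero, add_zero]
    · simp only [α', corr, if_neg hi]
      rw [hbad i hi, zero_add, heps, Finset.prod_const, Finset.card_univ, Fintype.card_fin,
        map_C, map_pow, C_pow]
  refine ⟨α', fun i j => ?_, ?_⟩
  · by_cases hi : good i
    · simp only [α', if_pos hi]; exact hi j
    · simp only [α', if_neg hi]; exact heps0
  · rw [hsum]
    refine isEpsApprox_iff_exists_map.mpr ⟨G + ∑ i, corr i, ?_, ?_⟩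
    · rw [map_add, hGg, map_sum]
    · rw [map_add, hGf, map_sum, Finset.sum_eq_zero, add_zero]
      intro i _
      by_cases hi : good i
      · simp only [corr, if_pos hi, map_zero]
      · simp only [corr, if_neg hi, map_C, map_pow]
        -- `d ≥ 1` here: a bad index has a form, so `Fin d` is nonempty
        have hd : d ≠ 0 := by
          rintro rfl
          exact hi fun j => j.elim0
        rw [Polynomial.constantCoeff_apply, Polynomial.coeff_X_zero, C_0, zero_pow hd]

/-- ★ **Stage-0 input in regular position** (packaging for the glue): if
`f ∈ \overline{Σ^{[k]}Π^{[d]}Σ}` over `F`, then `f` is approximated by `∑_i ∏_j ℓ_{ij}` with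
ALL `ℓ_{ij} ≠ 0`, and for every field `F′` that is a fraction field of `F[y_τ]`, with generic
point `(y_{e m})_m`, the shifted base changes of all the `ℓ_{ij}` are `ε`-regular (hypothesis
`ha` of `exists_regularModel_prod_affine`, for each `i`) and have nonzero constant terms.
[cite: DuttaDwivediSaxena2022, §3 proof of Thm. 3.2, the map `Φ` and the random point (full version p0028 L751–754)] -/
theorem exists_forms_regular_generic_shift {τ : Type*} {F' : Type*} [Field F']
    [Algebra (MvPolynomial τ F) F'] [IsFractionRing (MvPolynomial τ F) F'] [Algebra F F']
    [IsScalarTower F (MvPolynomial τ F) F'] (e : Fin n → τ) (he : Function.Injective e)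
    {k d : ℕ} {f : MvPolynomial (Fin n) F} (hf : f ∈ border (spsClass (RatFunc F) n k d)) :
    ∃ α : Fin k → Fin d → Option (Fin n) → RatFunc F, (∀ i j, α i j ≠ 0) ∧
      MS2021.IsEpsApprox f (∑ i, ∏ j, (C (α i j none) + ∑ m, C (α i j (some m)) * X m)) ∧
      ∀ (a' : Fin k → Fin d → Option (Fin n) → RatFunc F'),
        (∀ i j, a' i j none = ratFuncMap (algebraMap F F') (α i j none) +
          ∑ m, ratFuncMap (algebraMap F F') (α i j (some m)) *
            algebraMap F' (RatFunc F') (algebraMap (MvPolynomial τ F) F' (X (e m)))) →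
        (∀ i j m, a' i j (some m) = ratFuncMap (algebraMap F F') (α i j (some m))) →
        ∀ i j, (∃ (c : RatFunc F') (b : Option (Fin n) → F'[X]), c ≠ 0 ∧
          (∀ o, a' i j o = c * algebraMap F'[X] (RatFunc F') (b o)) ∧
            (b none).coeff 0 ≠ 0) ∧ a' i j none ≠ 0 := by
  obtain ⟨α, hα, happrox⟩ := exists_isEpsApprox_forall_ne_zero hf
  refine ⟨α, hα, happrox, fun a' hnone hsome i j => ?_⟩
  have h := exists_regular_of_generic_shift e he (hα i j) (hnone i j) (hsome i j)
  exact ⟨h, none_ne_zero_of_regular h⟩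

end Consequences

/-! ## (v2) The `hreg` / `h0` hypotheses of the F(x)-side transcript, discharged

`ne_zero_of_affForm_ne_zero`, `ne_zero_of_shift_ne_zero`, ★ `hreg_of_shift` /
★★ `hreg_of_generic_shift` and `none_ne_zero_of_generic_shift`: the hypotheses `hreg`
(`∀ i j, affForm (T′ i j) ≠ 0 → ε-regular`) and `h0` (`… → T′ i j none ≠ 0`) of the F(x)-side
transcript file `AC/DDS21TranscriptResidues.lean` (`exists_fx_transcript`,
`exists_stageZero_epsLim`), DISCHARGED in their own binder shape over an affinely free point /
the generic point. -/

section HReg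

variable {F : Type*} [Field F] {n : ℕ}

/-- A nonzero affine form has a nonzero coefficient vector. (folklore)
[cite: DuttaDwivediSaxena2022, Def. 3.1 (full version p0026 L702–707)] -/
theorem ne_zero_of_affForm_ne_zero {K : Type*} [CommSemiring K] {a : Option (Fin n) → K}
    (h : (C (a none) + ∑ m, C (a (some m)) * X m : MvPolynomial (Fin n) K) ≠ 0) : a ≠ 0 := by
  rintro rfl
  exact h affForm_zero

/-- Base change and shift reflect non-vanishing of coefficient vectors: if the shifted base
change `a′` (characterising hypotheses `hnone`/`hsome`) is nonzero then so is `a`. (folklore)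
[cite: DuttaDwivediSaxena2022, §3 proof of Thm. 3.2, the map `Φ` (full version p0028 L751–754)] -/
theorem ne_zero_of_shift_ne_zero {F' : Type*} [Field F'] (φ : F →+* F') (y : Fin n → F')
    {a : Option (Fin n) → RatFunc F} {a' : Option (Fin n) → RatFunc F'}
    (hnone : a' none = ratFuncMap φ (a none) +
      ∑ m, ratFuncMap φ (a (some m)) * algebraMap F' (RatFunc F') (y m))
    (hsome : ∀ m, a' (some m) = ratFuncMap φ (a (some m))) (h : a' ≠ 0) : a ≠ 0 := by
  rintro rfl
  apply h
  funext o
  rcases o with _ | m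
  · rw [hnone, Pi.zero_apply, Pi.zero_apply, map_zero, zero_add]
    exact Finset.sum_eq_zero fun m _ => by rw [Pi.zero_apply, map_zero, zero_mul]
  · rw [hsome, Pi.zero_apply, Pi.zero_apply, map_zero]

/-- ★ **`hreg` discharged (affinely free point).** For forms `T i j` over `F(ε)` and their shifted
base changes `T′ i j` at an affinely free point `y` (characterising hypotheses), every `T′ i j`
whose affine form is NONZERO is `ε`-regular — the hypothesis `hreg` of the F(x)-side transcript
(`AC/DDS21TranscriptResidues.lean`, `exists_fx_transcript`) in its own binder shape.
[cite: DuttaDwivediSaxena2022, §3 proof of Thm. 3.2, "it suffices to ensure that `Φ(T_{i,0})|_{x=0} = T_{i,0}(α) ≠ 0`" (full version p0028 L751–754)] -/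
theorem hreg_of_shift {F' : Type*} [Field F'] (φ : F →+* F') (y : Fin n → F')
    (hy : ∀ c : Option (Fin n) → F, φ (c none) + ∑ m, φ (c (some m)) * y m = 0 → c = 0)
    {k d : ℕ} {T : Fin k → Fin d → Option (Fin n) → RatFunc F}
    {T' : Fin k → Fin d → Option (Fin n) → RatFunc F'}
    (hnone : ∀ i j, T' i j none = ratFuncMap φ (T i j none) +
      ∑ m, ratFuncMap φ (T i j (some m)) * algebraMap F' (RatFunc F') (y m))
    (hsome : ∀ i j m, T' i j (some m) = ratFuncMap φ (T i j (some m))) :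
    ∀ i j, (C (T' i j none) + ∑ m, C (T' i j (some m)) * X m :
        MvPolynomial (Fin n) (RatFunc F')) ≠ 0 →
      ∃ (c : RatFunc F') (b : Option (Fin n) → F'[X]), c ≠ 0 ∧
        (∀ o, T' i j o = c * algebraMap F'[X] (RatFunc F') (b o)) ∧ (b none).coeff 0 ≠ 0 :=
  fun i j hij => exists_regular_of_shift φ y hy
    (ne_zero_of_shift_ne_zero φ y (hnone i j) (hsome i j) (ne_zero_of_affForm_ne_zero hij))
    (hnone i j) (hsome i j)

variable {τ : Type*} {F' : Type*} [Field F'] [Algebra (MvPolynomial τ F) F']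
  [IsFractionRing (MvPolynomial τ F) F'] [Algebra F F'] [IsScalarTower F (MvPolynomial τ F) F']

/-- ★★ **`hreg` discharged over the generic point**: with `F′` a fraction field of `F[y_τ]`,
`e : Fin n ↪ τ`, forms `T i j` over `F(ε)` and their shifted base changes `T′ i j` at the point
`(y_{e m})_m` (characterising hypotheses), every `T′ i j` with nonzero affine form is
`ε`-regular — literally `hreg` of `exists_fx_transcript`.
[cite: DuttaDwivediSaxena2022, §3 proof of Thm. 3.2, the map `Φ` and the random point (full version p0028 L751–754)] -/
theorem hreg_of_generic_shift (e : Fin n → τ) (he : Function.Injective e)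
    {k d : ℕ} {T : Fin k → Fin d → Option (Fin n) → RatFunc F}
    {T' : Fin k → Fin d → Option (Fin n) → RatFunc F'}
    (hnone : ∀ i j, T' i j none = ratFuncMap (algebraMap F F') (T i j none) +
      ∑ m, ratFuncMap (algebraMap F F') (T i j (some m)) *
        algebraMap F' (RatFunc F') (algebraMap (MvPolynomial τ F) F' (X (e m))))
    (hsome : ∀ i j m, T' i j (some m) = ratFuncMap (algebraMap F F') (T i j (some m))) :
    ∀ i j, (C (T' i j none) + ∑ m, C (T' i j (some m)) * X m :
        MvPolynomial (Fin n) (RatFunc F')) ≠ 0 →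
      ∃ (c : RatFunc F') (b : Option (Fin n) → F'[X]), c ≠ 0 ∧
        (∀ o, T' i j o = c * algebraMap F'[X] (RatFunc F') (b o)) ∧ (b none).coeff 0 ≠ 0 :=
  hreg_of_shift (algebraMap F F') (fun m => algebraMap (MvPolynomial τ F) F' (X (e m)))
    (fun c hc => generic_point_affinely_free e he c hc) hnone hsome

/-- ★ **`h0` discharged over the generic point**: under the same hypotheses every `T′ i j` with
nonzero affine form has a NONZERO CONSTANT TERM (`hL` of the DiDIL records; the hypothesis `h0`
of `exists_stageZero_epsLim`) — "`T_{i,0}(α) ≠ 0`" at the generic `α`.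
[cite: DuttaDwivediSaxena2022, §3 proof of Thm. 3.2, "`Φ(T_{i,0})|_{x=0} = T_{i,0}(α) ≠ 0`" (full version p0028 L751–754)] -/
theorem none_ne_zero_of_generic_shift (e : Fin n → τ) (he : Function.Injective e)
    {k d : ℕ} {T : Fin k → Fin d → Option (Fin n) → RatFunc F}
    {T' : Fin k → Fin d → Option (Fin n) → RatFunc F'}
    (hnone : ∀ i j, T' i j none = ratFuncMap (algebraMap F F') (T i j none) +
      ∑ m, ratFuncMap (algebraMap F F') (T i j (some m)) *
        algebraMap F' (RatFunc F') (algebraMap (MvPolynomial τ F) F' (X (e m))))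
    (hsome : ∀ i j m, T' i j (some m) = ratFuncMap (algebraMap F F') (T i j (some m))) :
    ∀ i j, (C (T' i j none) + ∑ m, C (T' i j (some m)) * X m :
        MvPolynomial (Fin n) (RatFunc F')) ≠ 0 → T' i j none ≠ 0 :=
  fun i j hij =>
    none_ne_zero_of_regular (hreg_of_generic_shift e he hnone hsome i j hij)

end HReg


end DDS2021

end Literature.Computability.AlgebraicComplexity
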